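import Literature.Geometry.Kaehler.ComplexTorusMixedHodgeIndexKernelAllBidegrees
import Literature.Geometry.Kaehler.ComplexTorusMixedHodgeRiemannEstimate
import HarnessLib

/-!
# Tuples of polarisations of an abelian variety: the mixed Hodge–Riemann package in every bidegree
# (Timorin / Dinh–Nguyên Theorems A, B, C, the mixed Hodge index theorem and the norm estimate, read for Riemann forms)

Layer `Literature/Geometry/Kaehler`, namespace `Literature.Geometry.Kaehler.ComplexTorus`; lane `lit-hodgefound`
(Track 2, HodgeConjecture, Layer A2 polarisations / A4 Hodge classes), seat p16, generation 25 (row g25-#4). Everything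
here is PROVED: theorems only, no definition, no named fact (net debt 0).

A polarisation of the complex torus `X = E/Φ(ℤ^ι)` is a Riemann form `η` (the tree's `IsRiemannForm Φ η`:
`η(i·, i·) = η`, integral on the lattice, `η(iu, u) > 0` — Lange–Birkenhake Lemma 2.1.7 / §4.1), and `ω = -η` is a
Kähler form whose class is `c₁(L)` of the corresponding ample line bundle. Hence a TUPLE OF POLARISATIONS
`(η_1, …, η_n)` is a positive background in the sense of T4b (`IsRiemannForm.tuple_mem_positiveTuples`) and every
theorem of the programme T1–T4 and of g25-#1…#3 applies verbatim. This file is the dictionary, stated on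
`H^{p,q}(X) = Λ^{p,q}` for an abelian variety `X` of dimension `g` with polarisations `L_0, …, L_n`
(`Ω_n := c₁(L_0) ⋯ c₁(L_{n-1})` as the constant form `(-η_0)_ℂ ∧ ⋯ ∧ (-η_{n-1})_ℂ`):

* THEOREM A (mixed Hodge–Riemann, Dinh–Nguyên Thm. 1.3 "Timorin's Theorem"): for `0 ≠ A ∈ H^{p,q}(X)`,
  `g = n + p + q`, with `c₁(L_0) ⋯ c₁(L_n) · A = 0`: `ε(k,p,q) ∫_X Ω_n ∧ A ∧ Ā > 0`
  (`IsRiemannForm.mixedHodgeRiemann_torusIntegral_pos`), and `h = Re(ε ∫_X Ω_n ∧ A ∧ B̄)` is positive definite on the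
  mixed primitive classes (`IsRiemannForm.posDef_hrFormPQ_restrict_primitiveReal`);
* THEOREM B (mixed hard Lefschetz): `A ↦ c₁(L_1) ⋯ c₁(L_r) · A` is a bijection `H^{p,q}(X) → H^{g-q,g-p}(X)`,
  `g = r + p + q` (`IsRiemannForm.mixedHardLefschetz_bijective`), with the quantitative bound `‖A‖² ≤ C ‖Ω · A‖²`
  (`IsRiemannForm.exists_norm_sq_le_norm_wedge_sq`);
* THEOREM C (mixed Lefschetz decomposition): `H^{p+1,q+1}(X) = P^{p+1,q+1} ⊕ c₁(L_n) · H^{p,q}(X)`, uniquely, with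
  `dim P^{p+1,q+1} = C(g,p+1) C(g,q+1) - C(g,p) C(g,q)` (`IsRiemannForm.exists_mem_mixedPrimitiveForms_add_wedge_eq`,
  `IsRiemannForm.mixedLefschetzDecomposition_unique`, `IsRiemannForm.finrank_mixedPrimitiveForms_inf_typeSubmodule`);
* THE MIXED HODGE INDEX THEOREM: the indices of inertia of `h` on `H^{p,q}(X)` are
  `b⁺ = 2 Σ_{j ≤ min(p,q)} (-1)^j C(g,p-j) C(g,q-j)`, `b⁻ = 2 Σ_{j < min(p,q)} (-1)^j C(g,p-1-j) C(g,q-1-j)`, the same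
  for every tuple of polarisations (`IsRiemannForm.sigPos_sigNeg_hrFormPQ`), `h` non-degenerate
  (`IsRiemannForm.hrFormPQ_nondegenerate`);
* DINH–NGUYÊN'S ESTIMATE (Prop. 2.2): `‖A‖² ≤ C₁ ‖c₁(L_0) ⋯ c₁(L_n) · A‖² + C₂ h(A, A)` on `H^{p,q}(X)`
  (`IsRiemannForm.exists_norm_sq_le`).

## Sources

* T.-C. Dinh, V.-A. Nguyên, *The mixed Hodge–Riemann bilinear relations for compact Kähler manifolds*, GAFA 16
  (2006) [DinhNguyen2006] (held `paper:arxiv-math_0501449`), p. 3 (chunk p0003) Thm. 1.3: "**(Timorin's Theorem)** If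
  `X` is a complex torus of dimension `n`, then `Q(·,·)` is positive definite on `P^{p,q}(X)`"; p. 4 (chunk p0004)
  Theorems B, C and "when `ω_j` are cohomologous to very ample divisors of `X` […] one deduces from the classical
  Hodge–Riemann theorem on the submanifold `D := D_1 ∩ ⋯ ∩ D_{n-p-q}` […]"; p. 5 (chunk p0005) Prop. 2.1, Prop. 2.2.
* V. A. Timorin, *Mixed Hodge–Riemann bilinear relations in a linear context*, Funct. Anal. Appl. 32 (1998)
  [Timorin1998], Main Theorem (through T4b).
* H. Lange, C. Birkenhake, *Complex Abelian Varieties* (1992) [LangeBirkenhake1992], Lemma 2.1.7 and §4.1 (Riemann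
  forms = polarisations; the first Chern class of a positive line bundle is a Kähler form); H. Lange, *Abelian
  Varieties over the Complex Numbers* (2023) [Lange2023AbelianVarietiesComplex], §1.1.5 Prop. 1.1.23, §2.2.1
  Lemma 2.2.2.
* C. Voisin, *Hodge Theory and Complex Algebraic Geometry I* (2002) [VoisinHodgeI2002], §6.3.2 Thm. 6.32 / 6.33.
-/

noncomputable section

set_option maxSynthPendingDepth 3

open scoped ComplexConjugate ComplexOrder
open Complex Function Module
open Literature.LinearAlgebra.Alternating
open Literature.Analysis.Complex (IsOfTypeAt typeSubmodule isOfTypeAt_of_mem_typeSubmodule)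

namespace Literature.Geometry.Kaehler

namespace ComplexTorus

universe u

open Literature.LinearAlgebra.QuadraticForm

variable {ι : Type*} [Fintype ι] [DecidableEq ι] {E : Type u} [NormedAddCommGroup E] [NormedSpace ℂ E]
  (Φ : (ι → ℝ) ≃L[ℝ] E)

/-! ## §1 Tuples of polarisations are positive backgrounds -/

omit [Fintype ι] [DecidableEq ι] in
/-- **A tuple of Riemann forms (polarisations) is a positive background** in the sense of T4b's `positiveTuples`
(`η(i·, i·) = η` and `η(iv, v) > 0`; the integrality condition is not needed).
[cite: LangeBirkenhake1992, Lemma 2.1.7 and §4.1] [cite: DinhNguyen2006, §2 Prop. 2.1 (arXiv PDF p. 5)] -/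
theorem IsRiemannForm.tuple_mem_positiveTuples {n : ℕ} {η : Fin n → E [⋀^Fin 2]→L[ℝ] ℝ}
    (hη : ∀ j, IsRiemannForm Φ (η j)) : η ∈ positiveTuples E n :=
  fun j ↦ ⟨(hη j).1, (hη j).2.2⟩

omit [Fintype ι] [DecidableEq ι] in
/-- A single polarisation repeated `n` times is a positive background (the classical, unmixed case).
[cite: LangeBirkenhake1992, Lemma 2.1.7 and §4.1] -/
theorem IsRiemannForm.const_mem_positiveTuples {η : E [⋀^Fin 2]→L[ℝ] ℝ} (hη : IsRiemannForm Φ η) (n : ℕ) :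
    (fun _ : Fin n ↦ η) ∈ positiveTuples E n :=
  ComplexTorus.const_mem_positiveTuples hη.1 hη.2.2 n

/-! ## §2 Theorem A: mixed Hodge–Riemann for tuples of polarisations -/

/-- **Mixed Hodge–Riemann bilinear relations for polarisations `L_0, …, L_n` of an abelian variety of dimension
`n + p + q`** (Dinh–Nguyên's Thm. 1.3 / Theorem A on a torus; Timorin): for `0 ≠ A ∈ H^{p,q}(X)` with
`c₁(L_0) ⋯ c₁(L_n) · A = 0`, `ε(k,p,q) ∫_X c₁(L_0) ⋯ c₁(L_{n-1}) ∧ A ∧ Ā > 0`, `ε(k,p,q) = (-1)^{k(k-1)/2} i^{p-q}`.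
[cite: DinhNguyen2006, §1 Thm. 1.3 and §2 Prop. 2.1 (b) (arXiv PDF pp. 3, 5)] [cite: Timorin1998, Main Theorem] -/
theorem IsRiemannForm.mixedHodgeRiemann_torusIntegral_pos {n k p q : ℕ} (e : Fin (2 * (n + k)) ≃ ι)
    (hpq : p + q = k) (h2 : 2 * n + (k + k) = 2 * (n + k)) {η : Fin (n + 1) → E [⋀^Fin 2]→L[ℝ] ℝ}
    (hη : ∀ j, IsRiemannForm Φ (η j)) {A : E [⋀^Fin k]→L[ℝ] ℂ} (hA : A ∈ typeSubmodule E k p q)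
    (hprim : (wedgeFamily (n + 1) fun j ↦ ofRealForm (-(η j))).wedge A = 0) (hA0 : A ≠ 0) :
    0 < hrSign k p q * torusIntegral Φ e (((wedgeFamily n fun j ↦ ofRealForm (-(η (Fin.castSucc j)))).wedge
      (A.wedge (conjForm A))).domDomCongr (finCongr h2)) :=
  haveI := finiteDimensional_complex Φ
  ComplexTorus.mixedHodgeRiemann_torusIntegral_pos Φ e (finrank_eq_of_finTwoMulEquiv Φ e) hpq h2
    (IsRiemannForm.tuple_mem_positiveTuples Φ hη) hA hprim hA0

/-- **Theorem A as positive definiteness**: for polarisations `L_0, …, L_n`, `dim X = n + p + q + 2`, the real form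
`h = Re(ε ∫_X c₁(L_0) ⋯ c₁(L_{n-1}) ∧ A ∧ B̄)` is positive definite on the mixed primitive classes
`P^{p+1,q+1} = {A ∈ H^{p+1,q+1}(X) : c₁(L_0) ⋯ c₁(L_n) · A = 0}`. [cite: DinhNguyen2006, §1 Thm. 1.3 and §2 Prop. 2.1 (b) (arXiv PDF pp. 3, 5)]
[cite: Timorin1998, Main Theorem] -/
theorem IsRiemannForm.posDef_hrFormPQ_restrict_primitiveReal {n m p q : ℕ} (e : Fin (2 * (n + (m + 2))) ≃ ι)
    (hpq : p + q = m) (h2 : 2 * n + ((m + 2) + (m + 2)) = 2 * (n + (m + 2))) {η : Fin (n + 1) → E [⋀^Fin 2]→L[ℝ] ℝ}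
    (hη : ∀ j, IsRiemannForm Φ (η j)) :
    ((hrFormPQ Φ e (hrSign (m + 2) (p + 1) (q + 1)) (wedgeFamily n (Fin.init fun j ↦ ofRealForm (-(η j)))) h2
        (p + 1) (q + 1)).toQuadraticMap.restrict (primitiveReal (fun j ↦ ofRealForm (-(η j))) (m + 2) (p + 1) (q + 1))).PosDef :=
  haveI := finiteDimensional_complex Φ
  ComplexTorus.posDef_hrFormPQ_restrict_primitiveReal_of_pos Φ e (finrank_eq_of_finTwoMulEquiv Φ e) hpq h2
    (IsRiemannForm.tuple_mem_positiveTuples Φ hη)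

/-! ## §3 Theorem B: mixed hard Lefschetz for tuples of polarisations -/

omit [DecidableEq ι] in
/-- **Mixed hard Lefschetz for polarisations `L_1, …, L_r`** of an abelian variety of dimension `r + p + q`:
`A ↦ c₁(L_1) ⋯ c₁(L_r) · A` is a bijection `H^{p,q}(X) → H^{r+p, r+q}(X) = H^{g-q, g-p}(X)` (Theorem B; Cattani's mixed
HLT). [cite: DinhNguyen2006, §1 Theorem B and §2 Prop. 2.1 (a) (arXiv PDF pp. 4–5)] [cite: Cattani2008MixedLefschetz, Thm. 1.3]
[cite: Timorin1998, Main Theorem] -/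
theorem IsRiemannForm.mixedHardLefschetz_bijective {r k p q K : ℕ} (e : Fin (2 * (r + k)) ≃ ι) (hpq : p + q = k)
    (hK : 2 * r + k = K) {η : Fin r → E [⋀^Fin 2]→L[ℝ] ℝ} (hη : ∀ j, IsRiemannForm Φ (η j)) :
    Function.Bijective ((mixedLefschetz (fun j ↦ ofRealForm (-(η j))) hK).restrict
      (p := typeSubmodule E k p q) (q := typeSubmodule E K (r + p) (r + q))
      (fun _ hA ↦ mixedLefschetz_mem_typeSubmodule
        (isOfTypeAt_of_mem_positiveTuples (IsRiemannForm.tuple_mem_positiveTuples Φ hη)) hK hpq hA)) :=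
  haveI := finiteDimensional_complex Φ
  ComplexTorus.mixedHardLefschetz_bijective_of_pos (finrank_eq_of_finTwoMulEquiv Φ e) hpq hK
    (IsRiemannForm.tuple_mem_positiveTuples Φ hη)

omit [DecidableEq ι] in
/-- Mixed hard Lefschetz for polarisations, injectivity in the language of forms.
[cite: DinhNguyen2006, §1 Theorem B (arXiv PDF p. 4)] [cite: Timorin1998, Main Theorem] -/
theorem IsRiemannForm.wedgeFamily_wedge_eq_zero_imp {r k p q : ℕ} (e : Fin (2 * (r + k)) ≃ ι) (hpq : p + q = k)
    {η : Fin r → E [⋀^Fin 2]→L[ℝ] ℝ} (hη : ∀ j, IsRiemannForm Φ (η j)) {A : E [⋀^Fin k]→L[ℝ] ℂ}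
    (hA : A ∈ typeSubmodule E k p q) (h0 : (wedgeFamily r fun j ↦ ofRealForm (-(η j))).wedge A = 0) : A = 0 :=
  haveI := finiteDimensional_complex Φ
  ComplexTorus.mixedHardLefschetz_of_pos_length (finrank_eq_of_finTwoMulEquiv Φ e) hpq
    (IsRiemannForm.tuple_mem_positiveTuples Φ hη) hA h0

omit [DecidableEq ι] in
/-- Mixed hard Lefschetz for polarisations, surjectivity with uniqueness: every class of type `(r+p, r+q)` is
`c₁(L_1) ⋯ c₁(L_r) · A` for a unique `A ∈ H^{p,q}(X)`. [cite: DinhNguyen2006, §1 Theorem B (arXiv PDF p. 4)]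
[cite: Timorin1998, Main Theorem] -/
theorem IsRiemannForm.mixedHardLefschetz_existsUnique {r k p q : ℕ} (e : Fin (2 * (r + k)) ≃ ι) (hpq : p + q = k)
    {η : Fin r → E [⋀^Fin 2]→L[ℝ] ℝ} (hη : ∀ j, IsRiemannForm Φ (η j))
    {B : E [⋀^Fin (2 * r + k)]→L[ℝ] ℂ} (hB : B ∈ typeSubmodule E (2 * r + k) (r + p) (r + q)) :
    ∃! A : E [⋀^Fin k]→L[ℝ] ℂ, A ∈ typeSubmodule E k p q ∧ (wedgeFamily r fun j ↦ ofRealForm (-(η j))).wedge A = B :=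
  haveI := finiteDimensional_complex Φ
  ComplexTorus.mixedHardLefschetz_existsUnique_of_pos (finrank_eq_of_finTwoMulEquiv Φ e) hpq
    (IsRiemannForm.tuple_mem_positiveTuples Φ hη) hB

omit [DecidableEq ι] in
/-- **Quantitative mixed hard Lefschetz for polarisations**: `‖A‖² ≤ C ‖c₁(L_1) ⋯ c₁(L_r) · A‖²` on `H^{p,q}(X)`.
[cite: DinhNguyen2006, §2 Prop. 2.2 (proof, (2.0)) (arXiv PDF p. 5)] -/
theorem IsRiemannForm.exists_norm_sq_le_norm_wedge_sq {r k p q : ℕ} (e : Fin (2 * (r + k)) ≃ ι) (hpq : p + q = k)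
    {η : Fin r → E [⋀^Fin 2]→L[ℝ] ℝ} (hη : ∀ j, IsRiemannForm Φ (η j)) :
    ∃ C : ℝ, 0 < C ∧ ∀ A ∈ typeSubmodule E k p q,
      ‖A‖ ^ 2 ≤ C * ‖(wedgeFamily r fun j ↦ ofRealForm (-(η j))).wedge A‖ ^ 2 :=
  haveI := finiteDimensional_complex Φ
  ComplexTorus.exists_norm_sq_le_norm_wedgeFamily_wedge_sq_of_pos (finrank_eq_of_finTwoMulEquiv Φ e) hpq
    (IsRiemannForm.tuple_mem_positiveTuples Φ hη)

/-! ## §4 Theorem C: the mixed Lefschetz decomposition for tuples of polarisations -/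

omit [DecidableEq ι] in
/-- **Mixed Lefschetz decomposition for polarisations `L_0, …, L_n`**, `dim X = n + p + q + 2` — existence: every
`A ∈ H^{p+1,q+1}(X)` is `B + C · c₁(L_n)` with `B` mixed primitive and `C ∈ H^{p,q}(X)`.
[cite: DinhNguyen2006, §1 Theorem C and §2 Prop. 2.1 (c) (arXiv PDF pp. 4–5)] [cite: Cattani2008MixedLefschetz, Thm. 2.2] -/
theorem IsRiemannForm.exists_mem_mixedPrimitiveForms_add_wedge_eq {n m p q : ℕ} (e : Fin (2 * (n + (m + 2))) ≃ ι)
    (hpq : p + q = m) {η : Fin (n + 1) → E [⋀^Fin 2]→L[ℝ] ℝ} (hη : ∀ j, IsRiemannForm Φ (η j))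
    {A : E [⋀^Fin (m + 2)]→L[ℝ] ℂ} (hA : A ∈ typeSubmodule E (m + 2) (p + 1) (q + 1)) :
    ∃ B ∈ mixedPrimitiveForms (fun j ↦ ofRealForm (-(η j))) (m + 2) ⊓ typeSubmodule E (m + 2) (p + 1) (q + 1),
      ∃ C ∈ typeSubmodule E m p q, A = B + C.wedge (ofRealForm (-(η (Fin.last n)))) :=
  haveI := finiteDimensional_complex Φ
  ComplexTorus.exists_mem_mixedPrimitiveForms_add_wedge_eq_of_pos (finrank_eq_of_finTwoMulEquiv Φ e) hpq rfl
    (IsRiemannForm.tuple_mem_positiveTuples Φ hη) hA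

omit [DecidableEq ι] in
/-- Mixed Lefschetz decomposition for polarisations — uniqueness.
[cite: DinhNguyen2006, §1 Theorem C and §2 Prop. 2.1 (c) (arXiv PDF pp. 4–5)] -/
theorem IsRiemannForm.mixedLefschetzDecomposition_unique {n m p q : ℕ} (e : Fin (2 * (n + (m + 2))) ≃ ι)
    (hpq : p + q = m) {η : Fin (n + 1) → E [⋀^Fin 2]→L[ℝ] ℝ} (hη : ∀ j, IsRiemannForm Φ (η j))
    {B B' : E [⋀^Fin (m + 2)]→L[ℝ] ℂ} (hB : B ∈ mixedPrimitiveForms (fun j ↦ ofRealForm (-(η j))) (m + 2))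
    (hB' : B' ∈ mixedPrimitiveForms (fun j ↦ ofRealForm (-(η j))) (m + 2))
    {C C' : E [⋀^Fin m]→L[ℝ] ℂ} (hC : C ∈ typeSubmodule E m p q) (hC' : C' ∈ typeSubmodule E m p q)
    (h : B + C.wedge (ofRealForm (-(η (Fin.last n)))) = B' + C'.wedge (ofRealForm (-(η (Fin.last n))))) :
    B = B' ∧ C = C' :=
  haveI := finiteDimensional_complex Φ
  ComplexTorus.mixedLefschetzDecomposition_unique_of_pos (finrank_eq_of_finTwoMulEquiv Φ e) hpq rfl
    (IsRiemannForm.tuple_mem_positiveTuples Φ hη) hB hB' hC hC' h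

omit [DecidableEq ι] in
/-- **`dim P^{p+1,q+1} = C(g,p+1) C(g,q+1) - C(g,p) C(g,q)`** for every tuple of polarisations.
[cite: DinhNguyen2006, §2 Prop. 2.1 (c) (arXiv PDF p. 5)] [cite: Lange2023AbelianVarietiesComplex, §1.1.5 Prop. 1.1.23] -/
theorem IsRiemannForm.finrank_mixedPrimitiveForms_inf_typeSubmodule {n m p q : ℕ} (e : Fin (2 * (n + (m + 2))) ≃ ι)
    (hpq : p + q = m) {η : Fin (n + 1) → E [⋀^Fin 2]→L[ℝ] ℝ} (hη : ∀ j, IsRiemannForm Φ (η j)) :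
    finrank ℂ ↥(mixedPrimitiveForms (fun j ↦ ofRealForm (-(η j))) (m + 2) ⊓ typeSubmodule E (m + 2) (p + 1) (q + 1)) =
      (n + (m + 2)).choose (p + 1) * (n + (m + 2)).choose (q + 1) - (n + (m + 2)).choose p * (n + (m + 2)).choose q :=
  haveI := finiteDimensional_complex Φ
  ComplexTorus.finrank_mixedPrimitiveForms_inf_typeSubmodule_of_pos (finrank_eq_of_finTwoMulEquiv Φ e) hpq rfl
    (IsRiemannForm.tuple_mem_positiveTuples Φ hη)

/-! ## §5 The mixed Hodge index theorem and the norm estimate for tuples of polarisations -/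

/-- **Non-degeneracy**: for polarisations `L_1, …, L_n`, `dim X = n + p + q`, the form
`h = Re(ε(k,p,q) ∫_X c₁(L_1) ⋯ c₁(L_n) ∧ A ∧ B̄)` on `H^{p,q}(X)` is non-degenerate.
[cite: DinhNguyen2006, §2 Prop. 2.1 (a) and §4 Remarks 4.2 (arXiv PDF pp. 5, 9)] -/
theorem IsRiemannForm.hrFormPQ_nondegenerate {n k p q : ℕ} (e : Fin (2 * (n + k)) ≃ ι) (hpq : p + q = k)
    (h2 : 2 * n + (k + k) = 2 * (n + k)) {η : Fin n → E [⋀^Fin 2]→L[ℝ] ℝ} (hη : ∀ j, IsRiemannForm Φ (η j)) :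
    (hrFormPQ Φ e (hrSign k p q) (wedgeFamily n fun j ↦ ofRealForm (-(η j))) h2 p q).Nondegenerate :=
  ComplexTorus.hrFormPQ_nondegenerate_of_pos Φ e rfl hpq h2 (IsRiemannForm.tuple_mem_positiveTuples Φ hη)

/-- **The mixed Hodge index theorem for tuples of polarisations**: the indices of inertia of `h` on `H^{p,q}(X)`
are `b⁺ = 2 Σ_{j ≤ min(p,q)} (-1)^j C(g,p-j) C(g,q-j)`, `b⁻ = 2 Σ_{j < min(p,q)} (-1)^j C(g,p-1-j) C(g,q-1-j)` —
independent of the polarisations. [cite: DinhNguyen2006, §2 Prop. 2.1 (b), (c) (arXiv PDF p. 5)] [cite: VoisinHodgeI2002, §6.3.2 Thm. 6.33] -/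
theorem IsRiemannForm.sigPos_sigNeg_hrFormPQ {g n k p q : ℕ} (e : Fin (2 * g) ≃ ι) (hnk : n + k = g) (hpq : p + q = k)
    (h2 : 2 * n + (k + k) = 2 * g) {η : Fin n → E [⋀^Fin 2]→L[ℝ] ℝ} (hη : ∀ j, IsRiemannForm Φ (η j)) :
    ((sigPos (hrFormPQ Φ e (hrSign k p q) (wedgeFamily n fun j ↦ ofRealForm (-(η j))) h2 p q).toQuadraticMap : ℕ) : ℤ) =
        2 * ∑ j ∈ Finset.range (min p q + 1), (-1) ^ j * ((g.choose (p - j) * g.choose (q - j) : ℕ) : ℤ) ∧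
      ((sigNeg (hrFormPQ Φ e (hrSign k p q) (wedgeFamily n fun j ↦ ofRealForm (-(η j))) h2 p q).toQuadraticMap : ℕ) : ℤ) =
        2 * ∑ j ∈ Finset.range (min p q), (-1) ^ j * ((g.choose (p - 1 - j) * g.choose (q - 1 - j) : ℕ) : ℤ) :=
  ComplexTorus.sigPos_sigNeg_hrFormPQ_of_pos Φ e hnk hpq h2 (IsRiemannForm.tuple_mem_positiveTuples Φ hη)

/-- **Dinh–Nguyên's estimate for polarisations `L_0, …, L_n`**, `dim X = n + p + q`:
`‖A‖² ≤ C₁ ‖c₁(L_0) ⋯ c₁(L_n) · A‖² + C₂ h(A, A)` on `H^{p,q}(X)`. [cite: DinhNguyen2006, §2 Prop. 2.2 (arXiv PDF p. 5)] -/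
theorem IsRiemannForm.exists_norm_sq_le {g n k p q : ℕ} (e : Fin (2 * g) ≃ ι) (hnk : n + k = g) (hpq : p + q = k)
    (h2 : 2 * n + (k + k) = 2 * g) {η : Fin (n + 1) → E [⋀^Fin 2]→L[ℝ] ℝ} (hη : ∀ j, IsRiemannForm Φ (η j)) :
    ∃ C₁ C₂ : ℝ, 0 < C₁ ∧ 0 < C₂ ∧ ∀ A ∈ typeSubmodule E k p q,
      ‖A‖ ^ 2 ≤ C₁ * ‖(wedgeFamily (n + 1) fun j ↦ ofRealForm (-(η j))).wedge A‖ ^ 2 +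
        C₂ * hrForm Φ e (hrSign k p q) (wedgeFamily n fun j ↦ ofRealForm (-(η (Fin.castSucc j)))) h2 A A :=
  ComplexTorus.exists_norm_sq_le_of_pos Φ e hnk hpq h2 (IsRiemannForm.tuple_mem_positiveTuples Φ hη)

/-- **One polarisation, every bidegree — the classical Hodge index count on `H^{p,q}(X)`**: for a polarised abelian
variety `(X, L)` of dimension `g = n + p + q`, the form `Re(ε(k,p,q) ∫_X c₁(L)^n ∧ A ∧ B̄)` on `H^{p,q}(X)` has indices
`b⁺ = 2 Σ_{j ≤ min(p,q)} (-1)^j C(g,p-j) C(g,q-j)`, `b⁻ = 2 Σ_{j < min(p,q)} (-1)^j C(g,p-1-j) C(g,q-1-j)` (the unmixed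
case of the mixed theorem: definite with alternating signs along the Lefschetz decomposition, Voisin's Thm. 6.32,
counted as in Thm. 6.33). [cite: VoisinHodgeI2002, §6.3.2 Thm. 6.32, Thm. 6.33] [cite: DinhNguyen2006, §1 Thm. 1.1 (arXiv PDF p. 3)] -/
theorem IsRiemannForm.sigPos_sigNeg_hrFormPQ_const {g n k p q : ℕ} (e : Fin (2 * g) ≃ ι) (hnk : n + k = g)
    (hpq : p + q = k) (h2 : 2 * n + (k + k) = 2 * g) {η : E [⋀^Fin 2]→L[ℝ] ℝ} (hη : IsRiemannForm Φ η) :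
    ((sigPos (hrFormPQ Φ e (hrSign k p q) (wedgeFamily n fun _ : Fin n ↦ ofRealForm (-η)) h2 p q).toQuadraticMap : ℕ) : ℤ) =
        2 * ∑ j ∈ Finset.range (min p q + 1), (-1) ^ j * ((g.choose (p - j) * g.choose (q - j) : ℕ) : ℤ) ∧
      ((sigNeg (hrFormPQ Φ e (hrSign k p q) (wedgeFamily n fun _ : Fin n ↦ ofRealForm (-η)) h2 p q).toQuadraticMap : ℕ) : ℤ) =
        2 * ∑ j ∈ Finset.range (min p q), (-1) ^ j * ((g.choose (p - 1 - j) * g.choose (q - 1 - j) : ℕ) : ℤ) :=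
  ComplexTorus.sigPos_sigNeg_hrFormPQ_of_pos Φ e hnk hpq h2 (s := fun _ : Fin n ↦ η)
    (IsRiemannForm.const_mem_positiveTuples Φ hη n)

end ComplexTorus

end Literature.Geometry.Kaehler

end
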